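import Literature.AlgebraicGeometry.Modules.PushforwardBaseChangeChartsTop
import HarnessLib

/-!
# Transporting sections of inverse images along open immersions and composites

Bookkeeping for the «base change is local on the base» reduction (★ `Modules/PushforwardBaseChangeRestrictBase`), in the
letters of the tree's pulled-back sections `unitSection` / `unitSectionLE` ([Hartshorne1977] II §5 p. 110, `f^*`):

* §1 sections over `O.ι ''ᵁ ⊤ = O`, `(f⁻¹U).ι ''ᵁ (f_U⁻¹ W′) = f⁻¹(U.ι ''ᵁ W′)` and the ring maps of Mathlib's `f.resLE U (f⁻¹U)`
  (`resLE_self_appLE_top_apply`, `resLE_self_app_top_apply`, `map_eqToHom_resLE_self_app_apply`);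
* §2 **`exists_sections_pullback_ι_transport`** — `μ : Γ(O.ι^* M, O₁) ≅ Γ(M, O)` (`O₁ = ⊤`), an additive bijection inverse to
  `m ↦ η_{O.ι}(m)|` (★ (S1) `bijective_unitSectionLE_ι`, with the explicit inverse through Mathlib `restrictFunctorIsoPullback`),
  semilinear along `Γ(O, O₁) → Γ(X, O)`;
* §3 **`exists_pullback_pullback_transport`** — for a commuting square `k ≫ ιX = ιXT ≫ pr` with `ιXT` an open immersion,
  `ν : Γ(k^* ιX^* G, U′) ≅ Γ(pr^* G, ιXT(U′))`, additive, bijective, `𝒪`-semilinear, with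
  `ν (η_k(η_{ιX}(m)|)|) = η_{pr}(m)|` — the composite of Mathlib's `pullbackComp`, `pullbackCongr`, `pullbackComp⁻¹`,
  `restrictFunctorIsoPullback⁻¹`, tracked on pulled-back sections by ★ `PullbackAffineChart` §Chase
  (`pullbackComp_hom_app_unitSection`, `pullbackCongr_hom_app_unitSection`, `pullbackComp_inv_app_unitSection`,
  `restrictFunctorIsoPullback_hom_app_map`).

Theorems only; no `sorry`, no instance, no named fact.  Cell hodgecm-mathlib, F-DAG (h2)/(h6-d), step (S3) of the split with
B-p19 (g15).  HC_CM is proved only modulo the printed citations until rung 0 closes; this file discharges none of them.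

## References
* [Hartshorne1977] R. Hartshorne, *Algebraic Geometry* (1977), II §5 p. 110 (`f^*`, `f_*`).
* [StacksProject] The Stacks Project, Tag 02N6 (base change map), Tag 01CB (functoriality of modules).
-/

noncomputable section

-- `TopCat.Presheaf`/`Scheme.Modules` are not reducible (as in Mathlib's `AlgebraicGeometry/Modules/Sheaf.lean`).
set_option backward.isDefEq.respectTransparency false

open CategoryTheory CategoryTheory.Limits AlgebraicGeometry TopologicalSpace Opposite TensorProduct

universe u

namespace Literature.AlgebraicGeometry.Modules

open Literature.AlgebraicGeometry.Motives

/-! ### §1 Sections bookkeeping for `resLE` -/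

section Bookkeeping

variable {X Y : Scheme.{u}} (f : X ⟶ Y) (U : Y.Opens)

/-- `(f⁻¹U).ι ''ᵁ (f_U⁻¹ W′) = f⁻¹ (U.ι ''ᵁ W′)` for `f_U = f.resLE U (f⁻¹U)` (the open subscheme `f⁻¹U` and the restricted
morphism). [cite: Hartshorne1977, II Ex. 2.2 (p. 79)] -/
theorem image_preimage_resLE_self (W' : U.toScheme.Opens) :
    (f ⁻¹ᵁ U).ι ''ᵁ ((f.resLE U (f ⁻¹ᵁ U) le_rfl) ⁻¹ᵁ W') = f ⁻¹ᵁ (U.ι ''ᵁ W') := by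
  rw [Scheme.Hom.resLE_preimage, Scheme.Hom.image_preimage_eq_opensRange_inf, Scheme.Opens.opensRange_ι]
  exact inf_eq_right.mpr (f.preimage_mono (U.ι_image_le W'))

/-- The ring map of `f_U = f.resLE U (f⁻¹U)` on `Γ(U, ⊤) → Γ(f⁻¹U, W′)` is `f♯ : Γ(S, U) → Γ(X, (f⁻¹U).ι ''ᵁ W′)` after
`Γ(U, ⊤) ≅ Γ(Y, U)` (Mathlib `resLE_appLE`, `map_appLE`; the structure sheaf of an open subscheme is the restriction).
[cite: Hartshorne1977, II Ex. 2.2 (p. 79)] -/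
theorem resLE_self_appLE_top_apply (W' : (f ⁻¹ᵁ U).toScheme.Opens) (a : Γ(U.toScheme, ⊤)) :
    (f.resLE U (f ⁻¹ᵁ U) le_rfl).appLE ⊤ W' le_top a =
      f.appLE U ((f ⁻¹ᵁ U).ι ''ᵁ W') ((f ⁻¹ᵁ U).ι_image_le W') (U.topIso.hom a) := by
  rw [Scheme.Hom.resLE_appLE, Scheme.Opens.topIso_hom, ← CommRingCat.comp_apply, Scheme.Hom.map_appLE]
  rfl

/-- The ring map of `f_U` on global sections is `f♯ : Γ(Y, U) → Γ(X, f⁻¹U)` between the `topIso`s (Mathlib `resLE_app_top`).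
[cite: Hartshorne1977, II Ex. 2.2 (p. 79)] -/
theorem resLE_self_app_top_apply (a : Γ(U.toScheme, ⊤)) :
    (f.resLE U (f ⁻¹ᵁ U) le_rfl).app ⊤ a = (f ⁻¹ᵁ U).topIso.inv (f.app U (U.topIso.hom a)) := by
  rw [Scheme.Hom.resLE_app_top, Scheme.Hom.appLE_eq_app]
  rfl

/-- `topIso.inv` followed by the restriction along `O = O.ι ''ᵁ ⊤` is the identity on `Γ(X, O)` (presheaf axiom `ρ_{UU} = id`).
[cite: Hartshorne1977, II §1 (p. 61)] -/
theorem map_eqToHom_topIso_inv (O : X.Opens) (z : Γ(X, O)) :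
    X.presheaf.map (eqToHom O.ι_image_top.symm).op (O.topIso.inv z) = z :=
  CategoryTheory.Iso.inv_hom_id_apply O.topIso z

/-- `Γ(O, ⊤) ≅ Γ(X, O)` IS the restriction along `O = O.ι ''ᵁ ⊤` (Mathlib `Opens.topIso`, by definition; open subscheme
structure sheaf). [cite: Hartshorne1977, II Ex. 2.2 (p. 79)] -/
theorem map_eqToHom_topIso_inv' (O : X.Opens) (c : Γ(X, O.ι ''ᵁ ⊤)) :
    X.presheaf.map (eqToHom O.ι_image_top.symm).op c = O.topIso.hom c := rfl

/-- Restricting a section of a module along `O = O.ι ''ᵁ ⊤` and back is the identity (presheaf axioms `ρ_{UU} = id`,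
`ρ ∘ ρ = ρ`). [cite: Hartshorne1977, II §1 (p. 61)] -/
theorem module_map_eqToHom_eqToHom (M : X.Modules) (O : X.Opens) (m : Γ(M, O)) :
    M.presheaf.map (eqToHom O.ι_image_top.symm).op (M.presheaf.map (eqToHom O.ι_image_top).op m) = m := by
  rw [← CategoryTheory.comp_apply, ← Functor.map_comp, ← op_comp, eqToHom_trans, eqToHom_refl, op_id,
    CategoryTheory.Functor.map_id]
  rfl

/-- Restricting a section of a module along `O.ι ''ᵁ ⊤ = O` and back is the identity (presheaf axioms `ρ_{UU} = id`,
`ρ ∘ ρ = ρ`). [cite: Hartshorne1977, II §1 (p. 61)] -/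
theorem module_map_eqToHom_eqToHom' (M : X.Modules) (O : X.Opens) (m : Γ(M, O.ι ''ᵁ ⊤)) :
    M.presheaf.map (eqToHom O.ι_image_top).op (M.presheaf.map (eqToHom O.ι_image_top.symm).op m) = m := by
  rw [← CategoryTheory.comp_apply, ← Functor.map_comp, ← op_comp, eqToHom_trans, eqToHom_refl, op_id,
    CategoryTheory.Functor.map_id]
  rfl

end Bookkeeping

/-! ### §2 The sections of `O.ι^* M` over `O₁ = ⊤` versus the sections of `M` over `O` -/

section Mu

variable {X : Scheme.{u}} (M : X.Modules) (O : X.Opens)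

/-- `restrictFunctorIsoPullback⁻¹` sends the pulled-back section `η_g(x)` to the restricted section `x|_{g(g⁻¹W)}`
(★ `restrictFunctorIsoPullback_hom_app_map`, inverted). [cite: Hartshorne1977, II §5 p. 110] -/
theorem restrictFunctorIsoPullback_inv_app_unitSection {X' : Scheme.{u}} (g : X' ⟶ X) [IsOpenImmersion g]
    (N : X.Modules) (W : X.Opens) (x : Γ(N, W)) :
    ((Scheme.Modules.restrictFunctorIsoPullback g).inv.app N).app (g ⁻¹ᵁ W) (unitSection g N W x) =
      (show Γ(N.restrict g, g ⁻¹ᵁ W) from N.presheaf.map (homOfLE (g.image_preimage_le W)).op x) := by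
  rw [← restrictFunctorIsoPullback_hom_app_map g N W x]
  have hid := congrArg (fun φ => Scheme.Modules.Hom.app φ (g ⁻¹ᵁ W)
      (show Γ(N.restrict g, g ⁻¹ᵁ W) from N.presheaf.map (homOfLE (g.image_preimage_le W)).op x))
    ((Scheme.Modules.restrictFunctorIsoPullback g).hom_inv_id_app N)
  simpa only [Scheme.Modules.Hom.comp_app, Scheme.Modules.Hom.id_app, CategoryTheory.comp_apply,
    CategoryTheory.id_apply] using hid

/-- `restrictFunctorIsoPullback⁻¹` followed by two restrictions: `η_g(x)|_{U′} ↦ x|_{W₀}` for `W₀ = g(U′)`, as sections of `N`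
(★ `restrictFunctorIsoPullback_hom_app_map`, inverted, and naturality in the open). [cite: Hartshorne1977, II §5 p. 110] -/
theorem map_restrictFunctorIsoPullback_inv_app_unitSection {X' : Scheme.{u}} (g : X' ⟶ X) [IsOpenImmersion g]
    (N : X.Modules) (W : X.Opens) {U' : X'.Opens} (r : U' ≤ g ⁻¹ᵁ W) {W₀ : X.Opens} (e₀ : W₀ = g ''ᵁ U')
    (h : W₀ ≤ W) (x : Γ(N, W)) :
    N.presheaf.map (eqToHom e₀).op
        (((Scheme.Modules.restrictFunctorIsoPullback g).inv.app N).app U'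
          (((Scheme.Modules.pullback g).obj N).presheaf.map (homOfLE r).op (unitSection g N W x))) =
      N.presheaf.map (homOfLE h).op x := by
  subst e₀
  rw [Scheme.Modules.Hom.app_map_apply ((Scheme.Modules.restrictFunctorIsoPullback g).inv.app N) (homOfLE r),
    restrictFunctorIsoPullback_inv_app_unitSection]
  change N.presheaf.map (eqToHom rfl).op (N.presheaf.map (g.opensFunctor.map (homOfLE r)).op
    (N.presheaf.map (homOfLE (g.image_preimage_le W)).op x)) = _
  rw [← CategoryTheory.comp_apply, ← CategoryTheory.comp_apply, ← Functor.map_comp, ← Functor.map_comp,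
    ← op_comp, ← op_comp]
  exact presheaf_map_congr _ _ _ _

/-- **`μ : Γ(O.ι^* M, O₁) ≅ Γ(M, O)` for `O₁ = ⊤`, packaged**: an additive bijection inverse to `m ↦ η_{O.ι}(m)|_{O₁}` (★ (S1)
`bijective_unitSectionLE_ι`, here with an explicit inverse through Mathlib `restrictFunctorIsoPullback`), semilinear along the
restriction `Γ(O, O₁) = Γ(X, O.ι ''ᵁ O₁) → Γ(X, O)`.  (`O₁` is any open EQUAL to `⊤`, e.g. `p_V⁻¹ ⊤`, so that consumers need no
cast.) [cite: Hartshorne1977, II §5 p. 110] -/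
theorem exists_sections_pullback_ι_transport (O₁ : O.toScheme.Opens) (hO₁ : O₁ = ⊤) (i₀ : O₁ ≤ O.ι ⁻¹ᵁ O)
    (hO : O = O.ι ''ᵁ O₁) :
    ∃ μ : Γ((Scheme.Modules.pullback O.ι).obj M, O₁) →+ Γ(M, O),
      (∀ m : Γ(M, O), μ (unitSectionLE O.ι M i₀ m) = m) ∧
      (∀ y, unitSectionLE O.ι M i₀ (μ y) = y) ∧
      (∀ (c : Γ(O.toScheme, O₁)) (y : Γ((Scheme.Modules.pullback O.ι).obj M, O₁)),
        μ (c • y) = X.presheaf.map (eqToHom hO).op c • μ y) := by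
  subst hO₁
  let μ : Γ((Scheme.Modules.pullback O.ι).obj M, ⊤) →+ Γ(M, O) :=
    (M.presheaf.map (eqToHom O.ι_image_top.symm).op).hom.comp
      (((Scheme.Modules.restrictFunctorIsoPullback O.ι).inv.app M).app ⊤).hom
  have hμ : ∀ y, μ y = M.presheaf.map (eqToHom O.ι_image_top.symm).op
      ((((Scheme.Modules.restrictFunctorIsoPullback O.ι).inv.app M).app ⊤) y) := fun y => rfl
  refine ⟨μ, fun m => ?_, fun y => ?_, fun c y => ?_⟩
  · rw [hμ, unitSectionLE_ι_eq_restrictFunctorIsoPullback]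
    have hid := congrArg (fun φ => Scheme.Modules.Hom.app φ ⊤ (show Γ(M.restrict O.ι, ⊤) from
        M.presheaf.map (eqToHom O.ι_image_top).op m))
      ((Scheme.Modules.restrictFunctorIsoPullback O.ι).hom_inv_id_app M)
    simp only [Scheme.Modules.Hom.comp_app, Scheme.Modules.Hom.id_app, CategoryTheory.comp_apply,
      CategoryTheory.id_apply] at hid
    rw [hid]
    exact module_map_eqToHom_eqToHom M O m
  · rw [hμ, unitSectionLE_ι_eq_restrictFunctorIsoPullback, module_map_eqToHom_eqToHom']
    have hid := congrArg (fun φ => Scheme.Modules.Hom.app φ ⊤ y)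
      ((Scheme.Modules.restrictFunctorIsoPullback O.ι).inv_hom_id_app M)
    simpa only [Scheme.Modules.Hom.comp_app, Scheme.Modules.Hom.id_app, CategoryTheory.comp_apply,
      CategoryTheory.id_apply] using hid
  · rw [hμ, hμ, Scheme.Modules.Hom.app_smul]
    have hs : (c • (((Scheme.Modules.restrictFunctorIsoPullback O.ι).inv.app M).app ⊤ y) :
        Γ(M.restrict O.ι, ⊤)) = ((O.ι.appIso ⊤).inv c) •
          (show Γ(M, O.ι ''ᵁ ⊤) from ((Scheme.Modules.restrictFunctorIsoPullback O.ι).inv.app M).app ⊤ y) := rfl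
    rw [hs, Scheme.Modules.map_smul]
    congr 1
    simp only [Scheme.Opens.ι_appIso, Iso.refl_inv]
    rfl

end Mu

/-! ### §3 The transport `ν : Γ(k^* ιX^* G, U′) ≅ Γ(pr^* G, ιXT(U′))` -/

section Nu

variable {X Y : Scheme.{u}}

/-- The ring map of `f_U = f.resLE U (f⁻¹U)` on `Γ(U, W′) → Γ(f⁻¹U, f_U⁻¹W′)` is `f♯ : Γ(Y, U.ι ''ᵁ W′) → Γ(X, f⁻¹(U.ι ''ᵁ W′))`
after the identification `Γ(f⁻¹U, f_U⁻¹ W′) = Γ(X, f⁻¹(U.ι ''ᵁ W′))` (Mathlib `resLE_appLE`, `appLE_map`; open subscheme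
structure sheaf). [cite: Hartshorne1977, II Ex. 2.2 (p. 79)] -/
theorem map_eqToHom_resLE_self_app_apply (f : X ⟶ Y) (U : Y.Opens) (W' : U.toScheme.Opens) (t : Γ(U.toScheme, W')) :
    X.presheaf.map (eqToHom (image_preimage_resLE_self f U W').symm).op
        (((f ⁻¹ᵁ U).ι.appIso ((f.resLE U (f ⁻¹ᵁ U) le_rfl) ⁻¹ᵁ W')).inv ((f.resLE U (f ⁻¹ᵁ U) le_rfl).app W' t)) =
      f.app (U.ι ''ᵁ W') (show Γ(Y, U.ι ''ᵁ W') from t) := by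
  have hid : ∀ z, ((f ⁻¹ᵁ U).ι.appIso ((f.resLE U (f ⁻¹ᵁ U) le_rfl) ⁻¹ᵁ W')).inv z = z := fun z => by
    simp only [Scheme.Opens.ι_appIso, Iso.refl_inv]
    rfl
  rw [hid, Scheme.Hom.app_eq_appLE (f.resLE U (f ⁻¹ᵁ U) le_rfl), Scheme.Hom.resLE_appLE]
  have hm := congrArg (fun φ => φ (show Γ(Y, U.ι ''ᵁ W') from t))
    (Scheme.Hom.appLE_map f (U := U.ι ''ᵁ W')
      ((Scheme.Hom.le_resLE_preimage_iff f (le_refl (f ⁻¹ᵁ U)) W' _).mp le_rfl)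
      (eqToHom (image_preimage_resLE_self f U W').symm).op)
  simp only [CommRingCat.comp_apply] at hm
  rw [Scheme.Hom.appLE_eq_app] at hm
  exact hm

/-- **`ν : Γ(k^* ιX^* G, U′) ≅ Γ(pr^* G, W₀)`, packaged**, for a commuting square `k ≫ ιX = ιXT ≫ pr` with `ιXT` an open
immersion and `W₀ = ιXT(U′)`: an additive bijection, semilinear along `Γ(X′₁, U′) = Γ(X_T, ιXT ''ᵁ U′) → Γ(X_T, W₀)`, sending
`η_k(η_{ιX}(m)|_{O₁})|_{U′}` to `η_{pr}(m)|_{W₀}` for `m ∈ Γ(G, O)`.  It is the composite of Mathlib's `pullbackComp`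
(`k^* ιX^* = (k ≫ ιX)^*`), `pullbackCongr` (`k ≫ ιX = ιXT ≫ pr`), `pullbackComp⁻¹` (`(ιXT ≫ pr)^* = ιXT^* pr^*`),
`restrictFunctorIsoPullback⁻¹` (`ιXT^* = (−)|`) and the restriction along `W₀ = ιXT ''ᵁ U′`, tracked on pulled-back sections by ★
`PullbackAffineChart` §Chase.  (Used below with `k = pr_V`, `ιX = (p⁻¹V).ι`, `ιXT = (pT⁻¹b⁻¹V).ι`.)
[cite: Hartshorne1977, II §5 p. 110] [cite: StacksProject, Tag 02N6] -/
theorem exists_pullback_pullback_transport {X₁ X'₁ XT : Scheme.{u}} (ιX : X₁ ⟶ X) (ιXT : X'₁ ⟶ XT) [IsOpenImmersion ιXT]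
    (k : X'₁ ⟶ X₁) (pr : XT ⟶ X) (hsq : k ≫ ιX = ιXT ≫ pr) (G : X.Modules)
    {O : X.Opens} {O₁ : X₁.Opens} (i₀ : O₁ ≤ ιX ⁻¹ᵁ O) {U' : X'₁.Opens} (j₁ : U' ≤ k ⁻¹ᵁ O₁)
    {W₀ : XT.Opens} (e₀ : W₀ = ιXT ''ᵁ U') (j₂ : W₀ ≤ pr ⁻¹ᵁ O) :
    ∃ ν : Γ((Scheme.Modules.pullback k).obj ((Scheme.Modules.pullback ιX).obj G), U') →+
        Γ((Scheme.Modules.pullback pr).obj G, W₀),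
      Function.Bijective ν ∧
      (∀ (c : Γ(X'₁, U')) (y : Γ((Scheme.Modules.pullback k).obj ((Scheme.Modules.pullback ιX).obj G), U')),
        ν (c • y) = XT.presheaf.map (eqToHom e₀).op ((ιXT.appIso U').inv c) • ν y) ∧
      (∀ m : Γ(G, O),
        ν (unitSectionLE k ((Scheme.Modules.pullback ιX).obj G) j₁ (unitSectionLE ιX G i₀ m)) =
          unitSectionLE pr G j₂ m) := by
  -- the four module morphisms (types ascribed in the non-composite form) and the final restriction
  let α₁ : (Scheme.Modules.pullback k).obj ((Scheme.Modules.pullback ιX).obj G) ⟶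
      (Scheme.Modules.pullback (k ≫ ιX)).obj G := (Scheme.Modules.pullbackComp k ιX).hom.app G
  let α₂ : (Scheme.Modules.pullback (k ≫ ιX)).obj G ⟶ (Scheme.Modules.pullback (ιXT ≫ pr)).obj G :=
    (Scheme.Modules.pullbackCongr hsq).hom.app G
  let α₃ : (Scheme.Modules.pullback (ιXT ≫ pr)).obj G ⟶
      (Scheme.Modules.pullback ιXT).obj ((Scheme.Modules.pullback pr).obj G) :=
    (Scheme.Modules.pullbackComp ιXT pr).inv.app G
  let α₄ : (Scheme.Modules.pullback ιXT).obj ((Scheme.Modules.pullback pr).obj G) ⟶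
      ((Scheme.Modules.pullback pr).obj G).restrict ιXT :=
    (Scheme.Modules.restrictFunctorIsoPullback ιXT).inv.app ((Scheme.Modules.pullback pr).obj G)
  let τ : Γ(((Scheme.Modules.pullback pr).obj G).restrict ιXT, U') ⟶ Γ((Scheme.Modules.pullback pr).obj G, W₀) :=
    ((Scheme.Modules.pullback pr).obj G).presheaf.map (eqToHom e₀).op
  let ν : Γ((Scheme.Modules.pullback k).obj ((Scheme.Modules.pullback ιX).obj G), U') →+
      Γ((Scheme.Modules.pullback pr).obj G, W₀) :=
    τ.hom.comp ((α₄.app U').hom.comp ((α₃.app U').hom.comp ((α₂.app U').hom.comp (α₁.app U').hom)))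
  have hν : ∀ y, ν y = τ (α₄.app U' (α₃.app U' (α₂.app U' (α₁.app U' y)))) := fun y => rfl
  refine ⟨ν, ?_, fun c y => ?_, fun m => ?_⟩
  · -- every factor is (a component of) an isomorphism
    have h₁ : Function.Bijective (α₁.app U') := ConcreteCategory.bijective_of_isIso _
    have h₂ : Function.Bijective (α₂.app U') := ConcreteCategory.bijective_of_isIso _
    have h₃ : Function.Bijective (α₃.app U') := ConcreteCategory.bijective_of_isIso _
    have h₄ : Function.Bijective (α₄.app U') := ConcreteCategory.bijective_of_isIso _
    have hτ : Function.Bijective τ := ConcreteCategory.bijective_of_isIso _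
    exact hτ.comp (h₄.comp (h₃.comp (h₂.comp h₁)))
  · -- semilinearity: the four module maps are `𝒪`-linear, the last step is `Scheme.Modules.map_smul`
    rw [hν, hν, Scheme.Modules.Hom.app_smul α₁, Scheme.Modules.Hom.app_smul α₂, Scheme.Modules.Hom.app_smul α₃,
      Scheme.Modules.Hom.app_smul α₄]
    have hs : ∀ (c : Γ(X'₁, U')) (z : Γ(((Scheme.Modules.pullback pr).obj G).restrict ιXT, U')),
        (c • z : Γ(((Scheme.Modules.pullback pr).obj G).restrict ιXT, U')) =
          (((ιXT.appIso U').inv c) • (show Γ((Scheme.Modules.pullback pr).obj G, ιXT ''ᵁ U') from z) :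
            Γ((Scheme.Modules.pullback pr).obj G, ιXT ''ᵁ U')) :=
      fun c z => rfl
    rw [hs]
    exact Scheme.Modules.map_smul ((Scheme.Modules.pullback pr).obj G) _ _ _
  · -- the value on `η_k(η_{ιX}(m)|_{O₁})|_{U′}`
    rw [hν]
    have hO : (k ≫ ιX) ⁻¹ᵁ O = (ιXT ≫ pr) ⁻¹ᵁ O := by rw [hsq]
    have hle₁ : U' ≤ (k ≫ ιX) ⁻¹ᵁ O := j₁.trans (k.preimage_mono i₀)
    have hle₂ : U' ≤ (ιXT ≫ pr) ⁻¹ᵁ O := hle₁.trans hO.le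
    -- Steps A/B: the argument is ONE restriction of `η_k(η_{ιX}(m))`
    have hA : unitSectionLE k ((Scheme.Modules.pullback ιX).obj G) j₁ (unitSectionLE ιX G i₀ m) =
        ((Scheme.Modules.pullback k).obj ((Scheme.Modules.pullback ιX).obj G)).presheaf.map (homOfLE hle₁).op
          (unitSection k ((Scheme.Modules.pullback ιX).obj G) (ιX ⁻¹ᵁ O) (unitSection ιX G O m)) := by
      simp only [unitSectionLE]
      rw [unitSection_map k ((Scheme.Modules.pullback ιX).obj G) (homOfLE i₀) (unitSection ιX G O m),
        ← CategoryTheory.comp_apply, ← Functor.map_comp, ← op_comp]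
      exact presheaf_map_congr _ _ _ _
    rw [hA]
    -- Steps C/D: `pullbackComp` sends `η_k(η_{ιX}(m))` to `η_{k ≫ ιX}(m)`
    have hD' : α₁.app ((k ≫ ιX) ⁻¹ᵁ O)
        (unitSection k ((Scheme.Modules.pullback ιX).obj G) (ιX ⁻¹ᵁ O) (unitSection ιX G O m)) =
          unitSection (k ≫ ιX) G O m :=
      pullbackComp_hom_app_unitSection ιX G k O m
    rw [Scheme.Modules.Hom.app_map_apply α₁ (homOfLE hle₁), hD']
    -- Step E: `pullbackCongr` sends `η_{k ≫ ιX}(m)` to `η_{ιXT ≫ pr}(m)`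
    have hE' : α₂.app ((k ≫ ιX) ⁻¹ᵁ O) (unitSection (k ≫ ιX) G O m) =
        ((Scheme.Modules.pullback (ιXT ≫ pr)).obj G).presheaf.map (eqToHom hO).op (unitSection (ιXT ≫ pr) G O m) :=
      pullbackCongr_hom_app_unitSection G hsq O m
    have hE : α₂.app U' (((Scheme.Modules.pullback (k ≫ ιX)).obj G).presheaf.map (homOfLE hle₁).op
          (unitSection (k ≫ ιX) G O m)) =
        ((Scheme.Modules.pullback (ιXT ≫ pr)).obj G).presheaf.map (homOfLE hle₂).op
          (unitSection (ιXT ≫ pr) G O m) := by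
      rw [Scheme.Modules.Hom.app_map_apply α₂ (homOfLE hle₁), hE', ← CategoryTheory.comp_apply, ← Functor.map_comp,
        ← op_comp]
      exact presheaf_map_congr _ _ _ _
    rw [hE]
    -- Step F: `pullbackComp⁻¹` sends `η_{ιXT ≫ pr}(m)` to `η_{ιXT}(η_{pr}(m))`
    have hF' : α₃.app ((ιXT ≫ pr) ⁻¹ᵁ O) (unitSection (ιXT ≫ pr) G O m) =
        unitSection ιXT ((Scheme.Modules.pullback pr).obj G) (pr ⁻¹ᵁ O) (unitSection pr G O m) :=
      pullbackComp_inv_app_unitSection pr G ιXT O m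
    rw [Scheme.Modules.Hom.app_map_apply α₃ (homOfLE hle₂), hF']
    -- Steps G/H: `restrictFunctorIsoPullback⁻¹` and the restrictions of `pr^* G`
    exact map_restrictFunctorIsoPullback_inv_app_unitSection ιXT ((Scheme.Modules.pullback pr).obj G) (pr ⁻¹ᵁ O)
      hle₂ e₀ j₂ (unitSection pr G O m)

end Nu

end Literature.AlgebraicGeometry.Modules

end
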